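import Summits.ValiantsHypothesis.ValiantsHypothesis.Theorems.SymPencilPerFourLowRankSeven

/-!
# Route `SymPencil` — six-dimensional singular subspaces with a detecting pair of rows: the
# minors force a zero column (brick (D1) of the `(10, 6)` cell of
# `Cruxes/SdcSuperquadratic/NEXT-RUNG-25.md`; `--supports` stmt-ValiantsHypothesis-5674)

**Theorem** (`exists_zero_col_of_detecting_rows_six`).  Over a field of characteristic `0`, let
`V` be a `6`-dimensional space of `4 × 4` matrices detected by the rows `p ≠ q` (an element of `V`
with rows `p, q` zero is zero) on which every `y` has the SWAPPED property with `< 6` squares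
(`rank (Hess per_4)(y) ≤ 5`).  Then some column `c₀` vanishes on the rows `p, q` of every element
of `V`.

Proof.  Val-width-5674-p2's minors (`SymPencilPerFourHessianMinors.exists_perm_col_vanish_of_sum_sq_swap`):
every column `m` has a partner `c ≠ m` with `x_{pc} x_{qm} + x_{pm} x_{qc} ≡ 0` on `V`.  For such a
pair `P = {m, c}` the four cells of rows `p, q` in the columns `P` map `V` onto a totally isotropic
subspace of the split quadric (dimension `≤ 2`, `AlperBogartVelasco.finrank_le_card_of_isotropic`),
so `U_P = V ∩ {those four cells = 0}` has dimension `≥ 4` and — by detection — is mapped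
isomorphically onto the four cells of rows `p, q` in the complementary columns.  Take `P₁ ∋ 0` and
then the partner `c₂` of a column `m₂ ∉ P₁`: `c₂ ∈ P₁` (the complementary pair of `P₁` carries an
element of `U_{P₁}` with non-zero subpermanent), and `V = U_{P₁} + U_{P₂}` by dimensions
(`U_{P₁} ∩ U_{P₂}` lives on one column: dimension `≤ 2`), whence the column `c₂ ∈ P₁ ∩ P₂`
vanishes on rows `p, q` throughout `V`.  (A single pair does not suffice: the twisted spaces
`{x_{pc} = -μ x_{pj}, x_{qc} = μ x_{qj}}` kill one subpermanent identically.)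

Honest framing: a lemma towards T6″; `sdc(per_4) ≥ 25` is the tree's value; the crux
`SdcSuperquadratic` and `VP ≠ VNP` are untouched.  No definitions, no named facts. [folklore]
-/

noncomputable section

-- single-conjunct layout: Sub = Summit, duplicated namespace component intended
set_option linter.dupNamespace false

namespace Summit.ValiantsHypothesis.ValiantsHypothesis.Theorems.SymPencilPerFourSixDimZeroCol

open Matrix MvPolynomial Finset Module
open Literature.Computability.AlgebraicComplexity
open Literature.Computability.AlgebraicComplexity.AlperBogartVelasco
open Summit.ValiantsHypothesis.ValiantsHypothesis.Theorems.SymPencilPerFourHessianMinors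
open Summit.ValiantsHypothesis.ValiantsHypothesis.Theorems.SymPencilPerFourLowRankSeven

variable {K : Type*} [Field K]

/-- The two columns complementary to two given distinct ones, with coverage. [folklore] -/
theorem exists_compl_cols (m c : Fin 4) (hmc : m ≠ c) :
    ∃ j₁ j₂ : Fin 4, j₁ ≠ j₂ ∧ j₁ ≠ m ∧ j₁ ≠ c ∧ j₂ ≠ m ∧ j₂ ≠ c ∧
      ∀ j : Fin 4, j = m ∨ j = c ∨ j = j₁ ∨ j = j₂ := by
  revert m c; decide

/-- **One isotropic pair of columns.**  If rows `p ≠ q` detect `V`, `dim V = 6`, and the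
subpermanent of rows `p, q` on the columns `m ≠ c` vanishes on `V`, then the elements of `V` whose
rows `p, q` vanish on the columns `m, c` realise EVERY prescription of the four cells of rows
`p, q` in the two complementary columns `j₁, j₂`, and form a subspace of dimension `≥ 4`. [folklore] -/
theorem full_compl_of_perm_vanish [CharZero K] (V : Submodule K (Fin 4 × Fin 4 → K))
    (h6 : finrank K V = 6) {p q : Fin 4}
    (hdet : ∀ x ∈ V, (∀ j, x (p, j) = 0) → (∀ j, x (q, j) = 0) → x = 0)
    {m c : Fin 4} (hmc : m ≠ c) (hq : ∀ x ∈ V, x (p, c) * x (q, m) + x (p, m) * x (q, c) = 0)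
    {j₁ j₂ : Fin 4} (hj : j₁ ≠ j₂) (hcov : ∀ j : Fin 4, j = m ∨ j = c ∨ j = j₁ ∨ j = j₂) :
    (∀ v : Fin 4 → K, ∃ x ∈ V, x (p, m) = 0 ∧ x (p, c) = 0 ∧ x (q, m) = 0 ∧ x (q, c) = 0 ∧
      x (p, j₁) = v 0 ∧ x (p, j₂) = v 1 ∧ x (q, j₁) = v 2 ∧ x (q, j₂) = v 3) ∧
    4 ≤ finrank K ↥(V ⊓ LinearMap.ker (LinearMap.prod
      (LinearMap.pi fun i : Fin 2 => (LinearMap.proj (![(p, c), (p, m)] i) :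
        (Fin 4 × Fin 4 → K) →ₗ[K] K))
      (LinearMap.pi fun i : Fin 2 => (LinearMap.proj (![(q, m), (q, c)] i) :
        (Fin 4 × Fin 4 → K) →ₗ[K] K)))) := by
  classical
  -- the four cells of the pair as a point of `K² × K²`
  set φ : (Fin 4 × Fin 4 → K) →ₗ[K] (Fin 2 → K) × (Fin 2 → K) :=
    LinearMap.prod (LinearMap.pi fun i => LinearMap.proj (![(p, c), (p, m)] i))
      (LinearMap.pi fun i => LinearMap.proj (![(q, m), (q, c)] i)) with hφdef
  have hφ1 : ∀ x, (φ x).1 = ![x (p, c), x (p, m)] := fun x => by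
    ext i; fin_cases i <;> rfl
  have hφ2 : ∀ x, (φ x).2 = ![x (q, m), x (q, c)] := fun x => by
    ext i; fin_cases i <;> rfl
  have hdot : ∀ x x' : Fin 4 × Fin 4 → K,
      (φ x).1 ⬝ᵥ (φ x').2 = x (p, c) * x' (q, m) + x (p, m) * x' (q, c) := fun x x' => by
    rw [hφ1, hφ2]
    simp [dotProduct, Fin.sum_univ_two]
  -- the image of `V` is totally isotropic: dimension `≤ 2`
  have hiso : ∀ z ∈ V.map φ, ∀ z' ∈ V.map φ, z.1 ⬝ᵥ z'.2 + z'.1 ⬝ᵥ z.2 = 0 := by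
    rintro _ ⟨x, hx, rfl⟩ _ ⟨x', hx', rfl⟩
    have h1 := hq (x + x') (V.add_mem hx hx')
    have h2 := hq x hx
    have h3 := hq x' hx'
    rw [hdot, hdot]
    simp only [Pi.add_apply] at h1
    linear_combination h1 - h2 - h3
  have hT2 : finrank K (V.map φ) ≤ 2 := by
    have h := finrank_le_card_of_isotropic (V.map φ) hiso
    rwa [Fintype.card_fin] at h
  set U := V ⊓ LinearMap.ker φ with hUdef
  have hU4 : 4 ≤ finrank K U := by
    have h := finrank_eq_finrank_map_add_finrank_inf_ker V φ
    rw [hUdef]; omega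
  have memU : ∀ x ∈ U, x ∈ V ∧ x (p, c) = 0 ∧ x (p, m) = 0 ∧ x (q, m) = 0 ∧ x (q, c) = 0 := by
    intro x hx
    rw [hUdef, Submodule.mem_inf, LinearMap.mem_ker] at hx
    refine ⟨hx.1, ?_, ?_, ?_, ?_⟩
    · simpa [hφ1] using congr_fun (congr_arg Prod.fst hx.2) 0
    · simpa [hφ1] using congr_fun (congr_arg Prod.fst hx.2) 1
    · simpa [hφ2] using congr_fun (congr_arg Prod.snd hx.2) 0
    · simpa [hφ2] using congr_fun (congr_arg Prod.snd hx.2) 1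
  -- the four complementary cells
  let cell : Fin 4 → Fin 4 × Fin 4 := ![(p, j₁), (p, j₂), (q, j₁), (q, j₂)]
  let G : (Fin 4 × Fin 4 → K) →ₗ[K] (Fin 4 → K) := LinearMap.pi fun i => LinearMap.proj (cell i)
  have hG : ∀ x i, G x i = x (cell i) := fun _ _ => rfl
  -- `G` is injective on `U` (detection)
  have hker : (U ⊓ LinearMap.ker G : Submodule K _) = ⊥ := by
    rw [eq_bot_iff]
    intro x hx
    rw [Submodule.mem_inf, LinearMap.mem_ker] at hx
    obtain ⟨hxV, hpc, hpm, hqm, hqc⟩ := memU x hx.1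
    have g0 : x (p, j₁) = 0 := by simpa [hG, cell] using congr_fun hx.2 0
    have g1 : x (p, j₂) = 0 := by simpa [hG, cell] using congr_fun hx.2 1
    have g2 : x (q, j₁) = 0 := by simpa [hG, cell] using congr_fun hx.2 2
    have g3 : x (q, j₂) = 0 := by simpa [hG, cell] using congr_fun hx.2 3
    rw [Submodule.mem_bot]
    refine hdet x hxV (fun j => ?_) (fun j => ?_)
    · rcases hcov j with rfl | rfl | rfl | rfl
      · exact hpm
      · exact hpc
      · exact g0
      · exact g1
    · rcases hcov j with rfl | rfl | rfl | rfl
      · exact hqm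
      · exact hqc
      · exact g2
      · exact g3
  have hUG : finrank K (U.map G) = finrank K U := by
    have h := finrank_eq_finrank_map_add_finrank_inf_ker U G
    rw [hker, finrank_bot, add_zero] at h
    exact h.symm
  have hle4 : finrank K (U.map G) ≤ 4 :=
    ((U.map G).finrank_le).trans (by rw [finrank_fintype_fun_eq_card, Fintype.card_fin])
  have htop : U.map G = ⊤ := by
    apply Submodule.eq_top_of_finrank_eq
    rw [finrank_fintype_fun_eq_card, Fintype.card_fin]
    omega
  refine ⟨fun v => ?_, hU4⟩
  have hv : v ∈ U.map G := by rw [htop]; exact Submodule.mem_top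
  obtain ⟨x, hxU, hGx⟩ := hv
  obtain ⟨hxV, hpc, hpm, hqm, hqc⟩ := memU x hxU
  refine ⟨x, hxV, hpm, hpc, hqm, hqc, ?_, ?_, ?_, ?_⟩
  · simpa [hG, cell] using congr_fun hGx 0
  · simpa [hG, cell] using congr_fun hGx 1
  · simpa [hG, cell] using congr_fun hGx 2
  · simpa [hG, cell] using congr_fun hGx 3

/-- **A detecting pair of rows and `rank Hess ≤ 5` in dimension `6` force a zero column on the
detecting rows.**  See the module docstring. [folklore] -/
theorem exists_zero_col_of_detecting_rows_six [CharZero K] {ι : Type*} [Fintype ι]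
    (hι : Fintype.card ι < 6) (V : Submodule K (Fin 4 × Fin 4 → K)) (h6 : finrank K V = 6)
    {p q : Fin 4} (hpq : p ≠ q)
    (hdet : ∀ x ∈ V, (∀ j, x (p, j) = 0) → (∀ j, x (q, j) = 0) → x = 0)
    (hW : ∀ y ∈ V, ∃ (c : ι → K) (Λ : ι → ((Fin 4 × Fin 4 → K) →ₗ[K] K)),
      ∀ u : Fin 4 × Fin 4 → K, ∃ e₀ e₁ : K, ∀ s : K,
        eval (u + s • y) (perPoly (Fin 4) K) = e₀ + s * e₁ + s ^ 2 * ∑ k, c k * (Λ k u) ^ 2) :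
    ∃ c₀ : Fin 4, ∀ x ∈ V, x (p, c₀) = 0 ∧ x (q, c₀) = 0 := by
  classical
  -- first pair `P₁ = {0, c₁}`
  obtain ⟨c₁, hc₁0, hq₁⟩ := exists_perm_col_vanish_of_sum_sq_swap hι V hW p q 0 hpq
  obtain ⟨j₁, j₂, hj12, hj10, hj1c, hj20, hj2c, hcov₁⟩ := exists_compl_cols 0 c₁ hc₁0.symm
  obtain ⟨hfull₁, hU₁⟩ := full_compl_of_perm_vanish V h6 hdet hc₁0.symm hq₁ hj12 hcov₁
  -- second pair: the partner `c₂` of `j₁`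
  obtain ⟨c₂, hc₂j, hq₂⟩ := exists_perm_col_vanish_of_sum_sq_swap hι V hW p q j₁ hpq
  -- `c₂ ≠ j₂`: otherwise the free cells of `P₁ᶜ = {j₁, j₂}` carry a non-zero subpermanent
  have hc₂j₂ : c₂ ≠ j₂ := by
    intro h
    subst h
    obtain ⟨x, hxV, -, -, -, -, hpj₁, hpj₂, hqj₁, hqj₂⟩ := hfull₁ ![1, 0, 0, 1]
    have h0 := hq₂ x hxV
    rw [hpj₁, hpj₂, hqj₁, hqj₂] at h0
    simp at h0
  -- hence `c₂ ∈ {0, c₁}`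
  have hc₂P : c₂ = 0 ∨ c₂ = c₁ := by
    rcases hcov₁ c₂ with h | h | h | h
    · exact Or.inl h
    · exact Or.inr h
    · exact absurd h hc₂j
    · exact absurd h hc₂j₂
  -- the second complementary pair is `{j₂, c₂'}` with `c₂'` the other element of `P₁`
  obtain ⟨c₂', hc₂'⟩ : ∃ c₂' : Fin 4, (c₂' = 0 ∨ c₂' = c₁) ∧ c₂' ≠ c₂ := by
    rcases hc₂P with h | h
    · exact ⟨c₁, Or.inr rfl, by rw [h]; exact hc₁0⟩
    · exact ⟨0, Or.inl rfl, by rw [h]; exact hc₁0.symm⟩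
  have hcov₂ : ∀ j : Fin 4, j = j₁ ∨ j = c₂ ∨ j = j₂ ∨ j = c₂' := by
    intro j
    rcases hcov₁ j with h | h | h | h
    · rcases hc₂P with h2 | h2
      · exact Or.inr (Or.inl (h.trans h2.symm))
      · rcases hc₂'.1 with h3 | h3
        · exact Or.inr (Or.inr (Or.inr (h.trans h3.symm)))
        · exact absurd (h3.trans h2.symm) hc₂'.2
    · rcases hc₂P with h2 | h2
      · rcases hc₂'.1 with h3 | h3
        · exact absurd (h3.trans h2.symm) hc₂'.2
        · exact Or.inr (Or.inr (Or.inr (h.trans h3.symm)))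
      · exact Or.inr (Or.inl (h.trans h2.symm))
    · exact Or.inl h
    · exact Or.inr (Or.inr (Or.inl h))
  have hj₂c₂' : j₂ ≠ c₂' := by
    rcases hc₂'.1 with h | h
    · rw [h]; exact hj20
    · rw [h]; exact hj2c
  obtain ⟨-, hU₂⟩ := full_compl_of_perm_vanish V h6 hdet hc₂j.symm hq₂ hj₂c₂' hcov₂
  -- `V = U₁ + U₂` by dimensions: `U₁ ∩ U₂` lives on the column `j₂` of rows `p, q`
  set φ₁ : (Fin 4 × Fin 4 → K) →ₗ[K] (Fin 2 → K) × (Fin 2 → K) :=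
    LinearMap.prod (LinearMap.pi fun i => LinearMap.proj (![(p, c₁), (p, (0 : Fin 4))] i))
      (LinearMap.pi fun i => LinearMap.proj (![(q, (0 : Fin 4)), (q, c₁)] i)) with hφ₁
  set φ₂ : (Fin 4 × Fin 4 → K) →ₗ[K] (Fin 2 → K) × (Fin 2 → K) :=
    LinearMap.prod (LinearMap.pi fun i => LinearMap.proj (![(p, c₂), (p, j₁)] i))
      (LinearMap.pi fun i => LinearMap.proj (![(q, j₁), (q, c₂)] i)) with hφ₂
  set U₁ := V ⊓ LinearMap.ker φ₁ with hU₁def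
  set U₂ := V ⊓ LinearMap.ker φ₂ with hU₂def
  have memU₁ : ∀ x ∈ U₁, x ∈ V ∧ x (p, c₁) = 0 ∧ x (p, 0) = 0 ∧ x (q, 0) = 0 ∧ x (q, c₁) = 0 := by
    intro x hx
    rw [hU₁def, Submodule.mem_inf, LinearMap.mem_ker] at hx
    refine ⟨hx.1, ?_, ?_, ?_, ?_⟩
    · have := congr_fun (congr_arg Prod.fst hx.2) 0; simpa [hφ₁] using this
    · have := congr_fun (congr_arg Prod.fst hx.2) 1; simpa [hφ₁] using this
    · have := congr_fun (congr_arg Prod.snd hx.2) 0; simpa [hφ₁] using this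
    · have := congr_fun (congr_arg Prod.snd hx.2) 1; simpa [hφ₁] using this
  have memU₂ : ∀ x ∈ U₂, x ∈ V ∧ x (p, c₂) = 0 ∧ x (p, j₁) = 0 ∧ x (q, j₁) = 0 ∧ x (q, c₂) = 0 := by
    intro x hx
    rw [hU₂def, Submodule.mem_inf, LinearMap.mem_ker] at hx
    refine ⟨hx.1, ?_, ?_, ?_, ?_⟩
    · have := congr_fun (congr_arg Prod.fst hx.2) 0; simpa [hφ₂] using this
    · have := congr_fun (congr_arg Prod.fst hx.2) 1; simpa [hφ₂] using this
    · have := congr_fun (congr_arg Prod.snd hx.2) 0; simpa [hφ₂] using this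
    · have := congr_fun (congr_arg Prod.snd hx.2) 1; simpa [hφ₂] using this
  -- `dim (U₁ ∩ U₂) ≤ 2`
  let G₂ : (Fin 4 × Fin 4 → K) →ₗ[K] (Fin 2 → K) :=
    LinearMap.pi fun i => LinearMap.proj (![(p, j₂), (q, j₂)] i)
  have hker12 : ((U₁ ⊓ U₂) ⊓ LinearMap.ker G₂ : Submodule K _) = ⊥ := by
    rw [eq_bot_iff]
    intro x hx
    rw [Submodule.mem_inf, Submodule.mem_inf, LinearMap.mem_ker] at hx
    obtain ⟨⟨hx1, hx2⟩, hG⟩ := hx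
    obtain ⟨hxV, a1, a2, a3, a4⟩ := memU₁ x hx1
    obtain ⟨-, b1, b2, b3, b4⟩ := memU₂ x hx2
    have g0 : x (p, j₂) = 0 := by simpa [G₂] using congr_fun hG 0
    have g1 : x (q, j₂) = 0 := by simpa [G₂] using congr_fun hG 1
    rw [Submodule.mem_bot]
    refine hdet x hxV (fun j => ?_) (fun j => ?_)
    · rcases hcov₁ j with rfl | rfl | rfl | rfl
      · exact a2
      · exact a1
      · exact b2
      · exact g0
    · rcases hcov₁ j with rfl | rfl | rfl | rfl
      · exact a3
      · exact a4
      · exact b3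
      · exact g1
  have hinf2 : finrank K ↥(U₁ ⊓ U₂) ≤ 2 := by
    have h := finrank_eq_finrank_map_add_finrank_inf_ker (U₁ ⊓ U₂) G₂
    rw [hker12, finrank_bot, add_zero] at h
    rw [h]
    exact (((U₁ ⊓ U₂).map G₂).finrank_le).trans
      (by rw [finrank_fintype_fun_eq_card, Fintype.card_fin])
  have hsup : U₁ ⊔ U₂ = V := by
    have hle : U₁ ⊔ U₂ ≤ V := sup_le inf_le_left inf_le_left
    have hdim := Submodule.finrank_sup_add_finrank_inf_eq U₁ U₂
    have hU₁' : 4 ≤ finrank K U₁ := by rw [hU₁def, hφ₁]; exact hU₁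
    have hU₂' : 4 ≤ finrank K U₂ := by rw [hU₂def, hφ₂]; exact hU₂
    exact Submodule.eq_of_le_of_finrank_le hle (by omega)
  refine ⟨c₂, fun x hx => ?_⟩
  rw [← hsup] at hx
  obtain ⟨u₁, hu₁, u₂, hu₂, rfl⟩ := Submodule.mem_sup.1 hx
  obtain ⟨-, a1, a2, a3, a4⟩ := memU₁ u₁ hu₁
  obtain ⟨-, b1, b2, b3, b4⟩ := memU₂ u₂ hu₂
  have hu₁p : u₁ (p, c₂) = 0 := by rcases hc₂P with h | h <;> rw [h] <;> assumption
  have hu₁q : u₁ (q, c₂) = 0 := by rcases hc₂P with h | h <;> rw [h] <;> assumption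
  exact ⟨by rw [Pi.add_apply, hu₁p, b1, add_zero], by rw [Pi.add_apply, hu₁q, b4, add_zero]⟩

end Summit.ValiantsHypothesis.ValiantsHypothesis.Theorems.SymPencilPerFourSixDimZeroCol

end
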